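import Summits.Langlands.Langlands.Theses.IrreducibilityBySelfDuality
import Literature.NumberTheory.GaloisRepresentations.FramedRepBlockSum
import Literature.NumberTheory.GaloisRepresentations.InducedGaloisRep
import Literature.NumberTheory.Automorphic.EssConjSelfDual

/-!
# `prime-rank-transport` — REGION skeleton for crux stmt-Langlands-14329 `IrreducibleOffSector`
# (route `IrreducibilityBySelfDuality`; crux-plan seat, 2026-08-17)

**THIS IS NOT A LINE.** There is deliberately NO `IrreducibleOffSector_of` in this file and it is
NOT registered with `ledger skeleton check`: the idea `prime-rank-transport` closes a REGION
`R_B ⊂ H4att'` of the crux (K CM, rank an odd prime `p`, `π'` regular algebraic cuspidal,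
polarizable, NOT essentially self-dual at Satake level), and by the certified map v4
(`irreducibleOffSector_text_of_open_regions_v4`, p126673) any composition concluding the crux BY
NAME would need a stub implying `hLA2res ∧ H3irr' ∧ H3esd' ∧ H4rest'` — the open problem itself
(Lines/Sketch-dead.md §4–§5, §7(c); TRIAGE-r2-1/2/3). See `Lines/prime-rank-transport.md`.

What this file IS: the idea turned into a CHECKED region skeleton that a `--supports
stmt-Langlands-14329` seat (or the tenure planner, for a v5 certified map) can consume:

* §0 vocabulary (verbatim from the v4 map / Sketch-r2-k5): `IsAttached`, `IsEssSelfDualSatake`;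
  new: `IsLieIrreducible`, `HasFiniteProjectiveImage`, `IsInducedFromDegree`, `IsTwistSelfDual`.
* §D1 a first draft of the DEFINITION ITEM "Lie algebra of the Zariski closure of a subgroup of
  `GL_n(F)` and its semisimple rank" (`zariskiLie`, `semisimpleRankOf`) — plain Mathlib, ~25 lines
  (after TRIAGE-r2-3's W.lean).
* §F the PRINTED inputs as named-fact Props, typed here so that the cite items have a target
  shape: `GabberPrimeDimension` (Katz, ESDE Thm 1.6), `Hui2013SemisimpleRank` (arXiv:1204.5271
  Thm 3.19 + Rem 3.22), `TateFiniteProjectiveLift` (Serre 1977 §6.5 / Patrikis 2019),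
  `PolarizedCoefficientModels` (BLGGT14 Thm 2.1.1 + §5.3 coefficient models),
  `PatrikisTaylorGoodPrime` (PT15 Thm 1.7).  POLARIZATION is typed with the tree's accepted
  `AutomorphicRepData.IsEssConjSelfDual π χ` (`π^c ≅ π^∨ ⊗ χ∘det`, file `EssConjSelfDual`) in the
  NORM-POWER specialisation `χ = ‖·‖_𝔸^m` (`IsPolarizedNorm`), exactly as the tree vendors
  Fakhruddin–Pilloni (`FakhruddinPilloni2021_galoisRep_of_weaklyRegular_normTwist`): for
  `χ = ‖·‖_K^m = ‖·‖_{K⁺}^m ∘ N_{K/K⁺}` BLGGT's factorisation through the norm holds and the sign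
  condition `χ₀,v(−1) = (−1)^n` (arXiv:1010.2561 §2.1, p. 17) is met by `χ₀ = ‖·‖^m ε_{K/K⁺}^n`, so
  every `π'` with `IsPolarizedNorm π'` is polarizable in BLGGT's sense (RACSDC = `m = 0`).  The
  general RAECSDC pair `(π, χ₀)` is definition item D2 (upgrade of the region, not needed here).
* §S seven STUBS (`theorem stub_* : … := by sorry`), each a genuine lemma of the line, and
* §A the sorry-free assemblies: `primeRankTransport_of` (stubs + facts ⇒ one good prime gives all
  primes), `regionB_of` (+ PT15 ⇒ the region is closed at EVERY `(ℓ, ι)`), and the v5 DISPATCH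
  lemma `isIrreducible_attached_of_primeRank_or_residual` (shape of the v4 map's
  `isIrreducible_attached_of_shavali_or_residual`): `H4att'` need only be asked OFF `R_B`.

`lean check`: rc 0, sorries = the 7 stubs exactly; assemblies use standard axioms + `sorryAx`
through the stubs only.
-/

noncomputable section

set_option linter.dupNamespace false
set_option linter.unusedVariables false

open scoped NumberField Classical Matrix
open Filter IsDedekindDomain NumberField Polynomial
open Literature.NumberTheory.Automorphic Literature.NumberTheory.GaloisRepresentations
open Summit.Langlands
open Summit.Langlands.Langlands.Theses.IrreducibilityBySelfDuality

attribute [local instance] LieRing.ofAssociativeRing LieAlgebra.ofAssociativeAlgebra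

namespace Summit.Langlands.Langlands.Cruxes.IrreducibleOffSector.PrimeRankTransport

/-! ## §0 Vocabulary -/

/-- `r` is the semisimple representation ATTACHED to `(π', ι)` in the C-normalisation at every
unramified `v ∤ ℓ` — VERBATIM the `H4att'` binder of the v4 certified map. -/
def IsAttached {n : ℕ} {K : Type} [Field K] [NumberField K]
    {hcpt : isCompact_glFiniteIntegralLevel n K} (π' : CuspidalAutomorphicRepData n K hcpt)
    {ℓ : ℕ} [Fact ℓ.Prime] (ι : PadicAlgCl ℓ ≃+* ℂ) (r : FramedGaloisRep K (PadicAlgCl ℓ) n) :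
    Prop :=
  r.toGaloisRep.IsSemisimple ∧
    ∀ (v : HeightOneSpectrum (𝓞 K)) (β : Multiset ℂ), π'.1.HasSatakeParamAt v β →
      ((ℓ : ℕ) : 𝓞 K) ∉ v.asIdeal →
        r.IsUnramifiedAt v ∧ r.HasFrobCharpolyAt v (arithFrobPolyOfSatake ι v.residueCard n β)

/-- `π'` is essentially self-dual AT SATAKE LEVEL — VERBATIM the v4 map's clause: some cuspidal
`GL(1)` datum `η` with `t_{π',v}⁻¹ = η(ϖ_v) · t_{π',v}` a.e. -/
def IsEssSelfDualSatake {n : ℕ} {K : Type} [Field K] [NumberField K]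
    {hcpt : isCompact_glFiniteIntegralLevel n K} (π' : CuspidalAutomorphicRepData n K hcpt) :
    Prop :=
  ∃ (h1 : isCompact_glFiniteIntegralLevel 1 K) (η : CuspidalAutomorphicRepData 1 K h1),
    ∀ᶠ v : HeightOneSpectrum (𝓞 K) in cofinite, ∀ β : Multiset ℂ, π'.1.HasSatakeParamAt v β →
      ∃ c : ℂ, η.1.HasSatakeParamAt v {c} ∧ β.map (fun a => a⁻¹) = β.map (fun a => c * a)

/-- **Polarized up to a norm power** (`K` CM): `π'^c ≅ π'^∨ ⊗ ‖det‖^m` for some `m ∈ ℤ`, in the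
tree's accepted pairing form `AutomorphicRepData.IsEssConjSelfDual π χ` with `χ = ‖·‖_𝔸^m`
(rendered as in `FakhruddinPilloni2021_galoisRep_of_weaklyRegular_normTwist`).  Such `π'` are
polarizable in the sense of BLGGT14 §2.1 (`χ = ‖·‖_{K⁺}^m ∘ N_{K/K⁺}`, sign condition met by
`χ₀ = ‖·‖^m ε_{K/K⁺}^n`); RACSDC is `m = 0`. -/
def IsPolarizedNorm {n : ℕ} {K : Type} [Field K] [NumberField K] [IsCMField K]
    {hcpt : isCompact_glFiniteIntegralLevel n K} (π' : CuspidalAutomorphicRepData n K hcpt) : Prop :=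
  ∃ (χ : HeckeCharacter K) (m : ℤ),
    (∀ x : ideleGroup K, ((χ x : ℂˣ) : ℂ) = (ideleNorm x : ℂ) ^ (m : ℂ)) ∧ π'.1.IsEssConjSelfDual χ

/-- The embedding `E ↪ ℂ ≃ ℚ̄_ℓ` of a subfield `E ⊂ ℂ` determined by `ι` (its closure is the
completion `E_λ` at the place `λ ∣ ℓ` that `ι⁻¹` induces on `E`). -/
def subfieldEmb (E : Subfield ℂ) {ℓ : ℕ} [Fact ℓ.Prime] (ι : PadicAlgCl ℓ ≃+* ℂ) :
    E →+* PadicAlgCl ℓ :=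
  (ι.symm : ℂ ≃+* PadicAlgCl ℓ).toRingHom.comp E.subtype

/-- The scalar value of a rank-one framed representation. -/
def scalar11 {G : Type*} [Group G] [TopologicalSpace G] {A : Type*} [CommRing A]
    [TopologicalSpace A] (c : FramedRep G A 1) (g : G) : A :=
  ((c g : GL (Fin 1) A) : Matrix (Fin 1) (Fin 1) A) 0 0

variable {K : Type} [Field K] [NumberField K] {ℓ : ℕ} [Fact ℓ.Prime] {n : ℕ}

/-- **Lie-irreducible**: irreducible on every open subgroup, i.e. after restriction to every
finite extension `F/K` (and, for convenience of the assembly, irreducible itself). -/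
def IsLieIrreducible (r : FramedGaloisRep K (PadicAlgCl ℓ) n) : Prop :=
  r.toGaloisRep.IsIrreducible ∧
    ∀ (F : Type) [Field F] [NumberField F] [Algebra K F], (r.restrictField F).toGaloisRep.IsIrreducible

/-- Shape (i) of the Clifford trichotomy: FINITE PROJECTIVE IMAGE — some open subgroup `Γ_F`
acts by scalars. -/
def HasFiniteProjectiveImage (r : FramedGaloisRep K (PadicAlgCl ℓ) n) : Prop :=
  ∃ (F : Type) (_ : Field F) (_ : NumberField F) (_ : Algebra K F),
    ∀ σ : Field.absoluteGaloisGroup F, ∃ c : PadicAlgCl ℓ,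
      ((r.restrictField F σ : GL (Fin n) (PadicAlgCl ℓ)) : Matrix (Fin n) (Fin n) (PadicAlgCl ℓ)) =
        c • (1 : Matrix (Fin n) (Fin n) (PadicAlgCl ℓ))

/-- Shape (ii): INDUCED from a character of a degree-`p` extension `F/K` (not necessarily
Galois): `r` is conjugate to `Ind_{Γ_F}^{Γ_K} χ` (tree `FramedGaloisRep.induce`, relabelled
`Fin (p * 1) ≃ Fin p`). -/
def IsInducedFromDegree (p : ℕ) (r : FramedGaloisRep K (PadicAlgCl ℓ) p) : Prop :=
  ∃ (F : Type) (_ : Field F) (_ : NumberField F) (_ : Algebra K F) (_ : FiniteDimensional K F)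
    (hF : Module.finrank K F = p) (χ : FramedGaloisRep F (PadicAlgCl ℓ) 1) (e : Fin (p * 1) ≃ Fin p)
    (P : GL (Fin p) (PadicAlgCl ℓ)), r = FramedRep.conj P (FramedRep.reindex e (χ.induce K hF))

/-- `r ≅ r^∨ ⊗ c` for a continuous character `c`: some conjugate of `r` is the `c`-twist of the
dual framed representation. -/
def IsTwistSelfDual (r : FramedGaloisRep K (PadicAlgCl ℓ) n) : Prop :=
  ∃ (c : FramedGaloisRep K (PadicAlgCl ℓ) 1) (P : GL (Fin n) (PadicAlgCl ℓ)),
    ∀ g : Field.absoluteGaloisGroup K,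
      ((FramedRep.conj P r g : GL (Fin n) (PadicAlgCl ℓ)) : Matrix (Fin n) (Fin n) (PadicAlgCl ℓ)) =
        scalar11 c g •
          ((FramedRep.dual r g : GL (Fin n) (PadicAlgCl ℓ)) : Matrix (Fin n) (Fin n) (PadicAlgCl ℓ))

/-! ## §D1 Lie algebra of the Zariski closure of a subgroup of `GL_n(F)`; semisimple rank
(first draft of definition item D1; topic Literature/NumberTheory/GaloisRepresentations) -/

section ZariskiLie

variable (F : Type) [Field F] (m : ℕ)

/-- Affine coordinates on `GL_m`: the `m²` entries and `y = det⁻¹`. -/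
abbrev GLCoord (m : ℕ) : Type := (Fin m × Fin m) ⊕ Unit

/-- The point of `𝔸^{m²+1}` underlying `g ∈ GL_m(F)`: entries of `g` and `det g⁻¹`. -/
def glPoint (g : GL (Fin m) F) : GLCoord m → F :=
  Sum.elim (fun ij => (g : Matrix (Fin m) (Fin m) F) ij.1 ij.2)
    (fun _ => (((g⁻¹ : GL (Fin m) F)) : Matrix (Fin m) (Fin m) F).det)

/-- The tangent direction at `1` determined by `X ∈ M_m(F)`: `(X, −tr X)` (the differential of
`y · det − 1` at `1` forces the `y`-component). -/
def glDir (X : Matrix (Fin m) (Fin m) F) : GLCoord m → F :=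
  Sum.elim (fun ij => X ij.1 ij.2) (fun _ => - X.trace)

/-- The ideal (as a set) of polynomials vanishing on `S ⊆ GL_m(F)`. -/
def vanishingSet (S : Set (GL (Fin m) F)) : Set (MvPolynomial (GLCoord m) F) :=
  {f | ∀ g ∈ S, MvPolynomial.eval (glPoint F m g) f = 0}

/-- The Zariski tangent space at `1` of the Zariski closure of `S`, read inside `M_m(F)`. -/
def zariskiTangentSet (S : Set (GL (Fin m) F)) : Set (Matrix (Fin m) (Fin m) F) :=
  {X | ∀ f ∈ vanishingSet F m S,
    ∑ c : GLCoord m, MvPolynomial.eval (glPoint F m 1) (MvPolynomial.pderiv c f) * glDir F m X c = 0}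

/-- **The Lie algebra of the Zariski closure of `S ⊆ GL_m(F)`** (for `S` a subgroup and `F`
algebraically closed of characteristic `0` this IS `Lie(Zar S) = Lie((Zar S)°)`, by Cartier's
smoothness theorem; `lieSpan` only makes the definition unconditional). -/
def zariskiLie (S : Set (GL (Fin m) F)) : LieSubalgebra F (Matrix (Fin m) (Fin m) F) :=
  LieSubalgebra.lieSpan F _ (zariskiTangentSet F m S)

/-- **Semisimple rank** of the Zariski closure of `S`: `rank 𝔤 − dim 𝔷(𝔤)` for `𝔤 = zariskiLie S`
(`=` rank of `[𝔤, 𝔤]` `=` semisimple rank of `(Zar S)°` when `𝔤` is reductive, e.g. for the image of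
a semisimple representation; the centre lies in every Cartan subalgebra, so `ℕ`-subtraction is safe). -/
def semisimpleRankOf (S : Set (GL (Fin m) F)) : ℕ :=
  LieAlgebra.rank F (zariskiLie F m S) -
    Module.finrank F (LieAlgebra.center F (zariskiLie F m S))

end ZariskiLie

/-! ## §F Printed inputs, typed as named-fact Props (targets of the cite items) -/

/-- **Gabber's prime-dimension theorem, corollary form** (Katz, *Exponential sums and differential
equations*, AM-124 (1990), Thm 1.6, p. 11: a semisimple `𝒢 ⊂ End(V)` acting irreducibly with
`dim V = p` prime is `𝔰𝔩₂` in `Sym^{p−1}(std)`, `𝔰𝔩(V)`, `𝔰𝔬(V)`, or (`p = 7`) `Lie(G₂)`; all but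
`𝔰𝔩(V)` preserve a non-degenerate symmetric form): over an algebraically closed field of
characteristic `0`, such a `𝒢` has dimension `p² − 1` or preserves a non-degenerate symmetric
bilinear form. -/
def GabberPrimeDimension : Prop :=
  ∀ (F : Type) [Field F] [IsAlgClosed F] [CharZero F] (V : Type) [AddCommGroup V] [Module F V]
    [FiniteDimensional F V] (L : LieSubalgebra F (Module.End F V)),
    LieAlgebra.IsSemisimple F L → (Module.finrank F V).Prime →
      (∀ W : Submodule F V, (∀ x ∈ L, ∀ w ∈ W, x w ∈ W) → W = ⊥ ∨ W = ⊤) →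
        Module.finrank F L = Module.finrank F V ^ 2 - 1 ∨
          ∃ B : LinearMap.BilinForm F V, B.Nondegenerate ∧ B.IsSymm ∧
            ∀ x ∈ L, ∀ v w : V, B (x v) w + B v (x w) = 0

/-- **Hui 2013, Thm 3.19 + Rem 3.22 (semisimple-rank corollary)** (arXiv:1204.5271, p. 13: for a
semisimple `E_λ`-adic compatible system the formal character of `(G_λ°)^der ↪ GL_n`, hence the
semisimple rank of `G_λ°`, is independent of `λ`), for families indexed by `(ℓ, ι)` (every `λ ∣ ℓ`
of `E` is `ι⁻¹|_E` for some `ι`; members at the same `λ` are CBN-conjugate up to `Gal(ℚ̄_ℓ/ℚ_ℓ)`,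
which does not change the rank): if every `r ℓ ι` is semisimple with entries in `E_λ =` the closure
of `ι⁻¹(E)`, and at all but finitely many `v` there is ONE `Q_v ∈ E[X]` which is the Frobenius
polynomial of every `r ℓ ι` with `v ∤ ℓ`, then all the `semisimpleRankOf (range (r ℓ ι))` agree. -/
def Hui2013SemisimpleRank : Prop :=
  ∀ (K : Type) [Field K] [NumberField K] (n : ℕ) (E : Subfield ℂ), FiniteDimensional ℚ E →
    ∀ r : ∀ (ℓ : ℕ) [Fact ℓ.Prime], (PadicAlgCl ℓ ≃+* ℂ) → FramedGaloisRep K (PadicAlgCl ℓ) n,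
      (∀ (ℓ : ℕ) [Fact ℓ.Prime] (ι : PadicAlgCl ℓ ≃+* ℂ), (r ℓ ι).toGaloisRep.IsSemisimple ∧
          ∀ (g : Field.absoluteGaloisGroup K) (i j : Fin n),
            ((r ℓ ι g : GL (Fin n) (PadicAlgCl ℓ)) : Matrix (Fin n) (Fin n) (PadicAlgCl ℓ)) i j ∈
              closure (Set.range (subfieldEmb E ι))) →
      (∀ᶠ v : HeightOneSpectrum (𝓞 K) in cofinite, ∃ Q : Polynomial E,
          ∀ (ℓ : ℕ) [Fact ℓ.Prime] (ι : PadicAlgCl ℓ ≃+* ℂ), ((ℓ : ℕ) : 𝓞 K) ∉ v.asIdeal →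
            (r ℓ ι).IsUnramifiedAt v ∧ (r ℓ ι).HasFrobCharpolyAt v (Q.map (subfieldEmb E ι))) →
      ∀ (ℓ₁ : ℕ) [Fact ℓ₁.Prime] (ι₁ : PadicAlgCl ℓ₁ ≃+* ℂ) (ℓ₂ : ℕ) [Fact ℓ₂.Prime]
        (ι₂ : PadicAlgCl ℓ₂ ≃+* ℂ),
        semisimpleRankOf (PadicAlgCl ℓ₁) n (Set.range (r ℓ₁ ι₁)) =
          semisimpleRankOf (PadicAlgCl ℓ₂) n (Set.range (r ℓ₂ ι₂))

/-- **Tate's lifting theorem, finite-image case** (Serre, *Modular forms of weight one and Galois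
representations* (1977), §6.5 (Tate: `H²(Γ_K, ℂ^×) = 0`); Patrikis, arXiv:1207.6724 §2 for
`ℚ̄_ℓ`-coefficients): a continuous `r : Γ_K → GL_n(ℚ̄_ℓ)` some open subgroup of which acts by
scalars is `σ ⊗ ψ` with `σ` of FINITE image and `ψ` a continuous character. -/
def TateFiniteProjectiveLift : Prop :=
  ∀ (K : Type) [Field K] [NumberField K] (ℓ : ℕ) [Fact ℓ.Prime] (n : ℕ)
    (r : FramedGaloisRep K (PadicAlgCl ℓ) n), HasFiniteProjectiveImage r →
      ∃ (σ : FramedGaloisRep K (PadicAlgCl ℓ) n) (ψ : FramedGaloisRep K (PadicAlgCl ℓ) 1),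
        (Set.range σ).Finite ∧
          ∀ g : Field.absoluteGaloisGroup K,
            ((r g : GL (Fin n) (PadicAlgCl ℓ)) : Matrix (Fin n) (Fin n) (PadicAlgCl ℓ)) =
              scalar11 ψ g • ((σ g : GL (Fin n) (PadicAlgCl ℓ)) : Matrix (Fin n) (Fin n) (PadicAlgCl ℓ))

/-- **Coefficient models for the attached system of a polarizable `π'`** (BLGGT14 = arXiv:1010.2561,
Thm 2.1.1 (existence: Shin, Chenevier–Harris, …) + Lemma 5.3.1(3) (after enlarging the CM
coefficient field `E ⊇ M_π`, every `r_{π',λ}` is `GL_n(E_λ)`-valued), as used in Hui 2023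
(arXiv:2208.04002) p. 4 and Patrikis–Taylor 2015 p. 7): for `K` CM and `π'` regular algebraic
cuspidal and polarizable there is a number field `E ⊂ ℂ` such that at every `(ℓ, ι)` SOME attached
`r` has all its entries in `E_λ =` the closure of `ι⁻¹(E)` in `ℚ̄_ℓ`. -/
def PolarizedCoefficientModels : Prop :=
  ∀ (n : ℕ) (K : Type) [Field K] [NumberField K] [IsCMField K]
    (hcpt : isCompact_glFiniteIntegralLevel n K) (π' : CuspidalAutomorphicRepData n K hcpt),
      π'.1.IsRegularAlgebraic → IsPolarizedNorm π' →
        ∃ E : Subfield ℂ, FiniteDimensional ℚ E ∧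
          ∀ (ℓ : ℕ) [Fact ℓ.Prime] (ι : PadicAlgCl ℓ ≃+* ℂ), ∃ r : FramedGaloisRep K (PadicAlgCl ℓ) n,
            IsAttached π' ι r ∧
              ∀ (g : Field.absoluteGaloisGroup K) (i j : Fin n),
                ((r g : GL (Fin n) (PadicAlgCl ℓ)) : Matrix (Fin n) (Fin n) (PadicAlgCl ℓ)) i j ∈
                  closure (Set.range (subfieldEmb E ι))

/-- **Patrikis–Taylor 2015, Thm 1.7, in the weak form the transport needs (ONE good prime)**
(arXiv:1307.1640, p. 8: `F` CM, `π` polarizable regular algebraic cuspidal ⇒ a positive-density set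
of `ℓ` such that `r_{π,λ}` is irreducible for EVERY `λ ∣ ℓ`; p. 7 for the normalisation
`rec(π_v |det|^{(1−n)/2})` = the C-normalisation of `IsAttached`): for `K` CM and `π'` regular
algebraic cuspidal polarizable on `GL_n`, `n ≥ 1`, at SOME `(ℓ₀, ι₀)` some attached `r₀` is
irreducible. -/
def PatrikisTaylorGoodPrime : Prop :=
  ∀ (n : ℕ), 0 < n → ∀ (K : Type) [Field K] [NumberField K] [IsCMField K]
    (hcpt : isCompact_glFiniteIntegralLevel n K) (π' : CuspidalAutomorphicRepData n K hcpt),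
      π'.1.IsRegularAlgebraic → IsPolarizedNorm π' →
        ∃ (ℓ₀ : ℕ) (_ : Fact ℓ₀.Prime) (ι₀ : PadicAlgCl ℓ₀ ≃+* ℂ)
          (r₀ : FramedGaloisRep K (PadicAlgCl ℓ₀) n), IsAttached π' ι₀ r₀ ∧ r₀.toGaloisRep.IsIrreducible

/-! ## §T The two targets of the region line -/

/-- **PRIME-RANK TRANSPORT** (the idea's lever, polarizable form): `p` prime, `K` CM, `π'` regular
algebraic cuspidal on `GL_p(𝔸_K)`, polarizable, NOT essentially self-dual at Satake level — if some
attached representation at ONE `(ℓ₀, ι₀)` is irreducible, every attached representation at EVERY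
`(ℓ, ι)` is irreducible. -/
def PrimeRankTransport : Prop :=
  ∀ (p : ℕ), p.Prime → ∀ (K : Type) [Field K] [NumberField K] [IsCMField K]
    (hcpt : isCompact_glFiniteIntegralLevel p K) (π' : CuspidalAutomorphicRepData p K hcpt),
      π'.1.IsRegularAlgebraic → IsPolarizedNorm π' → ¬ IsEssSelfDualSatake π' →
        (∃ (ℓ₀ : ℕ) (_ : Fact ℓ₀.Prime) (ι₀ : PadicAlgCl ℓ₀ ≃+* ℂ)
            (r₀ : FramedGaloisRep K (PadicAlgCl ℓ₀) p), IsAttached π' ι₀ r₀ ∧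
              r₀.toGaloisRep.IsIrreducible) →
          ∀ (ℓ : ℕ) [Fact ℓ.Prime] (ι : PadicAlgCl ℓ ≃+* ℂ) (r : FramedGaloisRep K (PadicAlgCl ℓ) p),
            IsAttached π' ι r → r.toGaloisRep.IsIrreducible

/-- **The region `R_B`, closed at EVERY `(ℓ, ι)`**: `K` CM, `p` prime, `π'` regular algebraic
cuspidal polarizable on `GL_p(𝔸_K)` and NOT essentially self-dual at Satake level ⇒ every attached
`r` at every `(ℓ, ι)` is irreducible (new for `p ≥ 7`; `p = 5` in substance Hui 2023 §4.4.1;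
`p = 3` is the route's sector / Böckle–Hui; `p = 2` vacuous). -/
def RegionB : Prop :=
  ∀ (p : ℕ), p.Prime → ∀ (K : Type) [Field K] [NumberField K] [IsCMField K]
    (hcpt : isCompact_glFiniteIntegralLevel p K) (π' : CuspidalAutomorphicRepData p K hcpt),
      π'.1.IsRegularAlgebraic → IsPolarizedNorm π' → ¬ IsEssSelfDualSatake π' →
        ∀ (ℓ : ℕ) [Fact ℓ.Prime] (ι : PadicAlgCl ℓ ≃+* ℂ) (r : FramedGaloisRep K (PadicAlgCl ℓ) p),
          IsAttached π' ι r → r.toGaloisRep.IsIrreducible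

/-! ## §S The stubs (genuine lemmas of the line; `sorry` only here) -/

/-- **B1 · rank count** (Lie side, provable now for `IsKilling`): a Lie algebra of endomorphisms
with non-degenerate Killing form preserving a non-trivial decomposition `V = W₁ ⊕ W₂` has rank at
most `dim V − 2` (a Cartan subalgebra is toral and sits in `𝔰𝔩(W₁) ⊕ 𝔰𝔩(W₂)`). -/
def RankCount : Prop :=
  ∀ (F : Type) [Field F] [IsAlgClosed F] [CharZero F] (V : Type) [AddCommGroup V] [Module F V]
    [FiniteDimensional F V] (L : LieSubalgebra F (Module.End F V)) [Module.Finite F L]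
    [LieAlgebra.IsKilling F L] (W₁ W₂ : Submodule F V), IsCompl W₁ W₂ → W₁ ≠ ⊥ → W₂ ≠ ⊥ →
      (∀ x ∈ L, (∀ w ∈ W₁, x w ∈ W₁) ∧ ∀ w ∈ W₂, x w ∈ W₂) →
        LieAlgebra.rank F L + 2 ≤ Module.finrank F V

theorem stub_rankCount : RankCount := by
  sorry

/-- **K4a · Clifford trichotomy in prime dimension** (open-subgroup form, no Zariski closure):
an irreducible `r : Γ_K → GL_p(ℚ̄_ℓ)`, `p` prime, has finite projective image, or is induced from a
character of a degree-`p` extension, or is Lie-irreducible (isotypic count `k ∣ p` on the normal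
core of a small open subgroup). -/
theorem stub_cliffordTrichotomy {K : Type} [Field K] [NumberField K] {ℓ : ℕ} [Fact ℓ.Prime]
    {p : ℕ} (hp : p.Prime) (r : FramedGaloisRep K (PadicAlgCl ℓ) p)
    (hirr : r.toGaloisRep.IsIrreducible) :
    HasFiniteProjectiveImage r ∨ IsInducedFromDegree p r ∨ IsLieIrreducible r := by
  sorry

/-- **K4b · shapes (i)/(ii) propagate to every `(ℓ, ι)`** (Tate lifting `hT`; Böckle–Hui 1.1 —
a THEOREM of the tree — for the character `ψ`, resp. `χ` on `Γ_F`; Weil's `ℓ`-adic avatars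
`HeckeCharacter.IsAlgebraic.exists_lAdic`; Chebotarev–Brauer–Nesbitt; Schur, resp. Mackey for a
NON-normal index-`p` subgroup — the tree's `isIrreducible_induce_of_not_conj` is the Galois case
only): if an attached `r₀` at `(ℓ₀, ι₀)` is irreducible of shape (i) or (ii), every attached `r`
at every `(ℓ, ι)` is irreducible.  `E`-rationality of the attached system from Clozel (`hHE`). -/
theorem stub_propagate_artinOrInduced (hT : TateFiniteProjectiveLift)
    (hHE : Clozel1990_heckeEigenvalueField)
    {p : ℕ} (hp : p.Prime) {K : Type} [Field K] [NumberField K]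
    {hcpt : isCompact_glFiniteIntegralLevel p K} (π' : CuspidalAutomorphicRepData p K hcpt)
    (hRA : π'.1.IsRegularAlgebraic)
    {ℓ₀ : ℕ} [Fact ℓ₀.Prime] (ι₀ : PadicAlgCl ℓ₀ ≃+* ℂ) (r₀ : FramedGaloisRep K (PadicAlgCl ℓ₀) p)
    (h₀ : IsAttached π' ι₀ r₀) (hirr₀ : r₀.toGaloisRep.IsIrreducible)
    (hshape : HasFiniteProjectiveImage r₀ ∨ IsInducedFromDegree p r₀)
    {ℓ : ℕ} [Fact ℓ.Prime] (ι : PadicAlgCl ℓ ≃+* ℂ) (r : FramedGaloisRep K (PadicAlgCl ℓ) p)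
    (hr : IsAttached π' ι r) : r.toGaloisRep.IsIrreducible := by
  sorry

/-- **K1a · type `A_{p−1}` is forced** (Gabber `hG` + the algebraic-group dictionary:
`Lie(Zar r(Γ_K))`-irreducible ⇔ Lie-irreducible; the image normalises `𝔰 = [𝔤, 𝔤]`; uniqueness of
the `𝔰`-invariant form up to scalar gives `G ⊂ GO(B)`, i.e. `r ≅ r^∨ ⊗ c`; `rank 𝔰𝔩_p = p − 1`):
a Lie-irreducible `r` of prime rank `p` which is NOT a twist of its dual has semisimple rank
`p − 1`. -/
theorem stub_fullRank_of_not_twistSelfDual (hG : GabberPrimeDimension)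
    {K : Type} [Field K] [NumberField K] {ℓ : ℕ} [Fact ℓ.Prime] {p : ℕ} (hp : p.Prime)
    (r : FramedGaloisRep K (PadicAlgCl ℓ) p) (hss : r.toGaloisRep.IsSemisimple)
    (hLie : IsLieIrreducible r) (hnsd : ¬ IsTwistSelfDual r) :
    semisimpleRankOf (PadicAlgCl ℓ) p (Set.range r) + 1 = p := by
  sorry

/-- **K1b · a twist-self-dual attached `r` makes `π'` essentially self-dual at Satake level**
(the character `c` weakly divides the semisimplification of `r ⊗ r`, which is `E`-rational by
Clozel `hHE`; Böckle–Hui 1.1 `exists_heckeCharacter_of_weaklyDivides_holds` makes `c` the avatar of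
an algebraic Hecke character `χ`; then `{β_j⁻¹} = {q_v^{n−1} χ_v⁻¹ β_j}` through
`roots_arithFrobPolyOfSatake`, and `η := χ̃ ⊗ |·|^{1−n}` is a cuspidal `GL(1)` datum by
`ContragredientDatum_holds` / `exists_automorphicRepData_detTwist_glOne`). -/
theorem stub_essSelfDualSatake_of_twistSelfDual (hHE : Clozel1990_heckeEigenvalueField)
    {n : ℕ} {K : Type} [Field K] [NumberField K] {hcpt : isCompact_glFiniteIntegralLevel n K}
    (π' : CuspidalAutomorphicRepData n K hcpt) (hRA : π'.1.IsRegularAlgebraic)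
    {ℓ : ℕ} [Fact ℓ.Prime] (ι : PadicAlgCl ℓ ≃+* ℂ) (r : FramedGaloisRep K (PadicAlgCl ℓ) n)
    (hr : IsAttached π' ι r) (hsd : IsTwistSelfDual r) : IsEssSelfDualSatake π' := by
  sorry

/-- **K2 applied · the semisimple rank of the attached representation does not depend on `(ℓ, ι)`**
(Hui 3.19 `hH` on the `E_λ`-valued family supplied by `hCo`, `E` enlarged by Clozel's Hecke field
`hHE` so that the C-normalised Satake polynomials are `E`-rational — integral `q_v`-powers only;
two attached representations at the same `(ℓ, ι)` are CBN-conjugate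
(`FramedGaloisRep.nonempty_equiv_of_hasFrobCharpolyAt_eventually chebotarev_artinRep_holds`) and
`semisimpleRankOf` is conjugation-invariant). -/
theorem stub_semisimpleRank_transport (hH : Hui2013SemisimpleRank)
    (hCo : PolarizedCoefficientModels) (hHE : Clozel1990_heckeEigenvalueField)
    {n : ℕ} {K : Type} [Field K] [NumberField K] [IsCMField K]
    {hcpt : isCompact_glFiniteIntegralLevel n K} (π' : CuspidalAutomorphicRepData n K hcpt)
    (hRA : π'.1.IsRegularAlgebraic) (hpol : IsPolarizedNorm π')
    {ℓ₁ : ℕ} [Fact ℓ₁.Prime] (ι₁ : PadicAlgCl ℓ₁ ≃+* ℂ) (r₁ : FramedGaloisRep K (PadicAlgCl ℓ₁) n)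
    (h₁ : IsAttached π' ι₁ r₁)
    {ℓ₂ : ℕ} [Fact ℓ₂.Prime] (ι₂ : PadicAlgCl ℓ₂ ≃+* ℂ) (r₂ : FramedGaloisRep K (PadicAlgCl ℓ₂) n)
    (h₂ : IsAttached π' ι₂ r₂) :
    semisimpleRankOf (PadicAlgCl ℓ₁) n (Set.range r₁) =
      semisimpleRankOf (PadicAlgCl ℓ₂) n (Set.range r₂) := by
  sorry

/-- **K1c · full semisimple rank forces Lie-irreducibility** (dictionary: a `Γ_F`-stable
complemented pair is `Zar`-stable hence `𝔤`-stable; `𝔰 = [𝔤, 𝔤]` is semisimple, so `IsKilling` by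
Cartan's criterion — a cited fact, absent from Mathlib; then the rank count `hB1`). -/
theorem stub_lieIrreducible_of_fullRank (hB1 : RankCount)
    {K : Type} [Field K] [NumberField K] {ℓ : ℕ} [Fact ℓ.Prime] {p : ℕ}
    (r : FramedGaloisRep K (PadicAlgCl ℓ) p) (hss : r.toGaloisRep.IsSemisimple)
    (hrank : semisimpleRankOf (PadicAlgCl ℓ) p (Set.range r) + 1 = p) : IsLieIrreducible r := by
  sorry

/-! ## §A Assemblies (sorry-free) -/

/-- **The transport from the stubs and the printed inputs** (pure logic + the trichotomy case
split).  Antecedents, in order: B1, K4a, K4b, K1a, K1b, K2-applied, K1c (the seven stub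
statements, verbatim), then the region's own inputs. -/
theorem primeRankTransport_of
    (hG : GabberPrimeDimension) (hH : Hui2013SemisimpleRank) (hT : TateFiniteProjectiveLift)
    (hCo : PolarizedCoefficientModels) (hHE : Clozel1990_heckeEigenvalueField)
    (s1 : RankCount)
    (s2 : ∀ {K : Type} [Field K] [NumberField K] {ℓ : ℕ} [Fact ℓ.Prime] {p : ℕ}, p.Prime →
      ∀ r : FramedGaloisRep K (PadicAlgCl ℓ) p, r.toGaloisRep.IsIrreducible →
        HasFiniteProjectiveImage r ∨ IsInducedFromDegree p r ∨ IsLieIrreducible r)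
    (s3 : TateFiniteProjectiveLift → Clozel1990_heckeEigenvalueField →
      ∀ {p : ℕ}, p.Prime → ∀ {K : Type} [Field K] [NumberField K]
        {hcpt : isCompact_glFiniteIntegralLevel p K} (π' : CuspidalAutomorphicRepData p K hcpt),
        π'.1.IsRegularAlgebraic →
        ∀ {ℓ₀ : ℕ} [Fact ℓ₀.Prime] (ι₀ : PadicAlgCl ℓ₀ ≃+* ℂ) (r₀ : FramedGaloisRep K (PadicAlgCl ℓ₀) p),
          IsAttached π' ι₀ r₀ → r₀.toGaloisRep.IsIrreducible →
          (HasFiniteProjectiveImage r₀ ∨ IsInducedFromDegree p r₀) →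
          ∀ {ℓ : ℕ} [Fact ℓ.Prime] (ι : PadicAlgCl ℓ ≃+* ℂ) (r : FramedGaloisRep K (PadicAlgCl ℓ) p),
            IsAttached π' ι r → r.toGaloisRep.IsIrreducible)
    (s4 : GabberPrimeDimension → ∀ {K : Type} [Field K] [NumberField K] {ℓ : ℕ} [Fact ℓ.Prime]
      {p : ℕ}, p.Prime → ∀ r : FramedGaloisRep K (PadicAlgCl ℓ) p, r.toGaloisRep.IsSemisimple →
        IsLieIrreducible r → ¬ IsTwistSelfDual r →
          semisimpleRankOf (PadicAlgCl ℓ) p (Set.range r) + 1 = p)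
    (s5 : Clozel1990_heckeEigenvalueField → ∀ {n : ℕ} {K : Type} [Field K] [NumberField K]
      {hcpt : isCompact_glFiniteIntegralLevel n K} (π' : CuspidalAutomorphicRepData n K hcpt),
      π'.1.IsRegularAlgebraic → ∀ {ℓ : ℕ} [Fact ℓ.Prime] (ι : PadicAlgCl ℓ ≃+* ℂ)
        (r : FramedGaloisRep K (PadicAlgCl ℓ) n), IsAttached π' ι r → IsTwistSelfDual r →
          IsEssSelfDualSatake π')
    (s6 : Hui2013SemisimpleRank → PolarizedCoefficientModels → Clozel1990_heckeEigenvalueField →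
      ∀ {n : ℕ} {K : Type} [Field K] [NumberField K] [IsCMField K]
        {hcpt : isCompact_glFiniteIntegralLevel n K} (π' : CuspidalAutomorphicRepData n K hcpt),
          π'.1.IsRegularAlgebraic → IsPolarizedNorm π' →
          ∀ {ℓ₁ : ℕ} [Fact ℓ₁.Prime] (ι₁ : PadicAlgCl ℓ₁ ≃+* ℂ) (r₁ : FramedGaloisRep K (PadicAlgCl ℓ₁) n),
            IsAttached π' ι₁ r₁ →
            ∀ {ℓ₂ : ℕ} [Fact ℓ₂.Prime] (ι₂ : PadicAlgCl ℓ₂ ≃+* ℂ) (r₂ : FramedGaloisRep K (PadicAlgCl ℓ₂) n),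
              IsAttached π' ι₂ r₂ →
                semisimpleRankOf (PadicAlgCl ℓ₁) n (Set.range r₁) =
                  semisimpleRankOf (PadicAlgCl ℓ₂) n (Set.range r₂))
    (s7 : RankCount → ∀ {K : Type} [Field K] [NumberField K] {ℓ : ℕ} [Fact ℓ.Prime] {p : ℕ}
      (r : FramedGaloisRep K (PadicAlgCl ℓ) p), r.toGaloisRep.IsSemisimple →
        semisimpleRankOf (PadicAlgCl ℓ) p (Set.range r) + 1 = p → IsLieIrreducible r) :
    PrimeRankTransport := by
  intro p hp K _ _ _ hcpt π' hRA hpol hnsd hgood ℓ _ ι r hr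
  obtain ⟨ℓ₀, hℓ₀, ι₀, r₀, h₀, hirr₀⟩ := hgood
  haveI : Fact ℓ₀.Prime := hℓ₀
  rcases s2 hp r₀ hirr₀ with hfin | hind | hLie
  · exact s3 hT hHE hp π' hRA ι₀ r₀ h₀ hirr₀ (Or.inl hfin) ι r hr
  · exact s3 hT hHE hp π' hRA ι₀ r₀ h₀ hirr₀ (Or.inr hind) ι r hr
  · -- Lie-irreducible at `λ₀`: not a twist of its dual (else ESD at Satake level, K1b),
    -- so semisimple rank `p − 1` at `λ₀` (K1a), hence at `λ` (K2), hence Lie-irreducible at `λ` (K1c).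
    have hnsd₀ : ¬ IsTwistSelfDual r₀ := fun hsd => hnsd (s5 hHE π' hRA ι₀ r₀ h₀ hsd)
    have hrank₀ : semisimpleRankOf (PadicAlgCl ℓ₀) p (Set.range r₀) + 1 = p :=
      s4 hG hp r₀ h₀.1 hLie hnsd₀
    have hrank : semisimpleRankOf (PadicAlgCl ℓ) p (Set.range r) + 1 = p := by
      rw [s6 hH hCo hHE π' hRA hpol ι r hr ι₀ r₀ h₀]; exact hrank₀
    exact (s7 s1 r hr.1 hrank).1

/-- The transport, modulo exactly the seven stubs of this file. -/
theorem primeRankTransport_modulo_stubs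
    (hG : GabberPrimeDimension) (hH : Hui2013SemisimpleRank) (hT : TateFiniteProjectiveLift)
    (hCo : PolarizedCoefficientModels) (hHE : Clozel1990_heckeEigenvalueField) :
    PrimeRankTransport :=
  primeRankTransport_of hG hH hT hCo hHE stub_rankCount
    (fun hp r hirr => stub_cliffordTrichotomy hp r hirr)
    (fun hT hHE _ hp _ _ _ _ π' hRA _ _ ι₀ r₀ h₀ hirr₀ hshape _ _ ι r hr =>
      stub_propagate_artinOrInduced hT hHE hp π' hRA ι₀ r₀ h₀ hirr₀ hshape ι r hr)
    (fun hG _ _ _ _ _ _ hp r hss hLie hnsd => stub_fullRank_of_not_twistSelfDual hG hp r hss hLie hnsd)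
    (fun hHE _ _ _ _ _ π' hRA _ _ ι r hr hsd =>
      stub_essSelfDualSatake_of_twistSelfDual hHE π' hRA ι r hr hsd)
    (fun hH hCo hHE _ _ _ _ _ _ π' hRA hpol _ _ ι₁ r₁ h₁ _ _ ι₂ r₂ h₂ =>
      stub_semisimpleRank_transport hH hCo hHE π' hRA hpol ι₁ r₁ h₁ ι₂ r₂ h₂)
    (fun hB1 _ _ _ _ _ _ r hss hrank => stub_lieIrreducible_of_fullRank hB1 r hss hrank)

/-- **The region is closed at every `(ℓ, ι)`** from the transport and Patrikis–Taylor's one good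
prime (pure logic). -/
theorem regionB_of (hT : PrimeRankTransport) (hPT : PatrikisTaylorGoodPrime) : RegionB := by
  intro p hp K _ _ _ hcpt π' hRA hpol hnsd ℓ _ ι r hr
  exact hT p hp K hcpt π' hRA hpol hnsd (hPT p hp.pos K hcpt π' hRA hpol) ℓ ι r hr

/-- **v5 DISPATCH** (shape of the v4 map's `isIrreducible_attached_of_shavali_or_residual`): inside
the `H4att'` binder, the attached `r` is irreducible — by the region theorem `hR` when `n` is prime,
`K` is CM, `π'` is polarizable and not essentially self-dual at Satake level, and by the residual
hypothesis `H4att''π` (premise "`n` prime → `K` CM → polarizable → ESD at Satake level") otherwise.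
A v5 certified map replaces `H4att'` by `H4att''` through this lemma (and Shavali's, unchanged). -/
theorem isIrreducible_attached_of_primeRank_or_residual (hR : RegionB)
    {n : ℕ} {K : Type} [Field K] [NumberField K]
    (hcpt : isCompact_glFiniteIntegralLevel n K) (π' : CuspidalAutomorphicRepData n K hcpt)
    (hRA : π'.1.IsRegularAlgebraic) {ℓ : ℕ} [Fact ℓ.Prime] (ι : PadicAlgCl ℓ ≃+* ℂ)
    (H4att''π : (n.Prime → ∀ (hK : IsCMField K), @IsPolarizedNorm n K _ _ hK hcpt π' →
        IsEssSelfDualSatake π') →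
      ∀ r : FramedGaloisRep K (PadicAlgCl ℓ) n, IsAttached π' ι r → r.toGaloisRep.IsIrreducible)
    (r : FramedGaloisRep K (PadicAlgCl ℓ) n) (hr : IsAttached π' ι r) :
    r.toGaloisRep.IsIrreducible := by
  by_cases hB : n.Prime ∧ ∃ hK : IsCMField K, @IsPolarizedNorm n K _ _ hK hcpt π' ∧
      ¬ IsEssSelfDualSatake π'
  · obtain ⟨hn, hK, hpol, hnsd⟩ := hB
    exact @hR n hn K _ _ hK hcpt π' hRA hpol hnsd ℓ _ ι r hr
  · refine H4att''π (fun hn hK hpol => ?_) r hr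
    by_contra hnsd
    exact hB ⟨hn, hK, hpol, hnsd⟩

/-- **End to end, modulo the seven stubs**: the printed inputs give the region. -/
theorem regionB_modulo_stubs
    (hG : GabberPrimeDimension) (hH : Hui2013SemisimpleRank) (hT : TateFiniteProjectiveLift)
    (hCo : PolarizedCoefficientModels) (hHE : Clozel1990_heckeEigenvalueField)
    (hPT : PatrikisTaylorGoodPrime) : RegionB :=
  regionB_of (primeRankTransport_modulo_stubs hG hH hT hCo hHE) hPT

/-! ## Probes: the crux by name elaborates; nothing here concludes it (by design). -/

example : Prop := IrreducibleOffSector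

end Summit.Langlands.Langlands.Cruxes.IrreducibleOffSector.PrimeRankTransport

end
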